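import Summits.Ventures.PercRepro.ProfilePriceCollision
import Summits.Ventures.PercRepro.ProfileMixedStepDropped

/-!
# PercRepro — the RANK-ANTICHAIN form `RAS` and its inductive step (p10, gen 0; S5, Proposition 2‴ in the kernel)

`MAS` (`ProfileMixedStep.lean`) is the profile-Hall inequality on antichains.  Night-3's `ProfileHall` (H⁺) quantifies
over ALL families of rank-`q` sets, comparable members included.  The common generalisation is the inequality on
RANK-ANTICHAINS — families in which comparable members have equal rank — `RAS M u`.  This file proves its
single-element inductive step (S5 Proposition 2‴):

* `Dropped M e 𝒜` — the members `B ∌ e` containing `B′ ∖ {e}` for a member `B′ ∋ e` with a different contraction rank;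
  removing them keeps the contraction shadow (`shadowLevel_image_sdiff_Dropped`) and leaves a rank-antichain of
  `M ／ {e}` (`image_sdiff_Dropped_rankAntichain`: the other comparabilities are rank-preserving, by
  `mem_clF_of_subset_of_rk_eq`);
* **`ras_step`** — for a non-loop `e` and a rank-antichain `𝒜` every dropped member of which has `e ∈ cl(E − e − B)`,
  `RAS (M ＼ {e}) u` and `RAS (M ／ {e}) (u − 1)` give the inequality for `(M, 𝒜, u)`: the members are paid fiber by
  fiber of `B ↦ B ∖ {e}` — a lone `B ∌ e` by `pi_le_delete_add_contract`, a lone `B ∋ e` by `pi_le_contract_erase`,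
  a COLLISION pair `{B, B ∪ {e}}` by `pi_add_pi_insert_le`, a dropped member by the deletion side alone
  (`pi_delete_eq_of_mem_closure`).
`RAS` itself is not claimed (the engine's exhaustive census: 0 violations on ≤ 6 elements); for antichains `ras_step`
specialises to `mas_step_of_dropped_mem_closure`.
-/

/-! ## The rank-antichain form RAS and its inductive step with collisions and dropped members (Proposition 2‴) -/

open scoped Matroid

namespace PercRepro.Skew

open Finset ThmH Shadow Profile

variable {α : Type} [DecidableEq α] {M : Matroid α} [M.Finite] {e : α} {u : ℕ}

/-- **RAS(M, u)**: the profile-Hall inequality for every RANK-ANTICHAIN of subsets of the ground set (comparable members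
have equal rank) — the common generalisation of `MAS` (antichains) and of night-3's `ProfileHall` (families of one
rank). -/
def RAS (M : Matroid α) [M.Finite] (u : ℕ) : Prop :=
  ∀ 𝒜 : Finset (Finset α), (∀ B ∈ 𝒜, B ⊆ gr M) → (∀ B ∈ 𝒜, ∀ B' ∈ 𝒜, B ⊆ B' → rk M B = rk M B') →
    ∑ B ∈ 𝒜, pi M u B ≤ ((shadowLevel M u 𝒜).card : ℚ)

omit [DecidableEq α] in
/-- Rank is monotone. -/
theorem rk_mono {X Y : Finset α} (h : X ⊆ Y) : rk M X ≤ rk M Y := by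
  have := M.eRk_mono (show (X : Set α) ⊆ (Y : Set α) by exact_mod_cast h)
  rw [← coe_rk, ← coe_rk] at this
  exact_mod_cast this

/-- If `X ⊆ Y` have the same rank and `e ∈ cl Y`, then `e ∈ cl X`. -/
theorem mem_clF_of_subset_of_rk_eq (he : e ∈ gr M) {X Y : Finset α} (hY : Y ⊆ gr M) (hXY : X ⊆ Y)
    (hr : rk M X = rk M Y) (hcl : e ∈ clF M Y) : e ∈ clF M X := by
  by_contra h
  have h1 : rk M (insert e X) = rk M X + 1 := by rw [rk_insert_eq he (hXY.trans hY), if_neg h]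
  have h2 : rk M (insert e Y) = rk M Y := by rw [rk_insert_eq he hY, if_pos hcl]
  have h3 : rk M (insert e X) ≤ rk M (insert e Y) := rk_mono (Finset.insert_subset_insert e hXY)
  omega

/-- The DROPPED members of a family at `e`: `B ∌ e` containing `B′ ∖ {e}` for some member `B′ ∋ e` whose contraction
rank differs from that of `B`. -/
noncomputable def Dropped (M : Matroid α) [M.Finite] (e : α) (𝒜 : Finset (Finset α)) : Finset (Finset α) :=
  𝒜.filter (fun B => e ∉ B ∧ ∃ B' ∈ 𝒜, e ∈ B' ∧ B'.erase e ⊆ B ∧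
    rk (M ／ ({e} : Set α)) (B'.erase e) ≠ rk (M ／ ({e} : Set α)) B)

/-- Membership in `Dropped`. -/
theorem mem_Dropped {𝒜 : Finset (Finset α)} {B : Finset α} :
    B ∈ Dropped M e 𝒜 ↔ B ∈ 𝒜 ∧ e ∉ B ∧ ∃ B' ∈ 𝒜, e ∈ B' ∧ B'.erase e ⊆ B ∧
      rk (M ／ ({e} : Set α)) (B'.erase e) ≠ rk (M ／ ({e} : Set α)) B := by
  unfold Dropped; rw [Finset.mem_filter]

/-- The contraction shadow of the whole image is the contraction shadow of the image of the non-dropped members. -/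
theorem shadowLevel_image_sdiff_Dropped (𝒜 : Finset (Finset α)) :
    shadowLevel (M ／ ({e} : Set α)) (u - 1) ((𝒜 \ Dropped M e 𝒜).image (fun B => B.erase e)) =
      shadowLevel (M ／ ({e} : Set α)) (u - 1) (𝒜.image (fun B => B.erase e)) := by
  ext S
  rw [mem_shadowLevel, mem_shadowLevel]
  constructor
  · rintro ⟨hS, T, hT, hTS⟩
    rw [Finset.mem_image] at hT
    obtain ⟨B, hB, rfl⟩ := hT
    exact ⟨hS, B.erase e, Finset.mem_image_of_mem _ (Finset.mem_sdiff.1 hB).1, hTS⟩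
  · rintro ⟨hS, T, hT, hTS⟩
    rw [Finset.mem_image] at hT
    obtain ⟨B, hB, rfl⟩ := hT
    by_cases hD : B ∈ Dropped M e 𝒜
    · obtain ⟨-, heB, B', hB', heB', hsub, -⟩ := mem_Dropped.1 hD
      refine ⟨hS, B'.erase e, Finset.mem_image_of_mem _ (Finset.mem_sdiff.2 ⟨hB', ?_⟩), ?_⟩
      · intro h; exact (mem_Dropped.1 h).2.1 heB'
      · rw [Finset.erase_eq_of_notMem heB] at hTS
        exact hsub.trans hTS
    · exact ⟨hS, B.erase e, Finset.mem_image_of_mem _ (Finset.mem_sdiff.2 ⟨hB, hD⟩), hTS⟩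

/-- `rk (M ／ {e}) B` for `e ∉ B`: `rk M B − [e ∈ cl B]`. -/
theorem rk_contract_of_notMem (he : M.Indep {e}) {B : Finset α} (hB : B ⊆ gr M) (heB : e ∉ B) :
    rk (M ／ ({e} : Set α)) B + 1 = (if e ∈ clF M B then rk M B else rk M B + 1) := by
  rw [rk_contract_add_one he (Finset.subset_erase.2 ⟨hB, heB⟩), rk_insert_eq (mem_gr_of_indep he) hB]

/-- `rk (M ／ {e}) (B ∖ e) + 1 = rk M B` for `e ∈ B`. -/
theorem rk_contract_erase_of_mem (he : M.Indep {e}) {B : Finset α} (hB : B ⊆ gr M) (heB : e ∈ B) :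
    rk (M ／ ({e} : Set α)) (B.erase e) + 1 = rk M B := by
  rw [rk_contract_add_one he (Finset.erase_subset_erase e hB), Finset.insert_erase heB]


/-- The image of the non-dropped members is a rank-antichain of `M ／ {e}`. -/
theorem image_sdiff_Dropped_rankAntichain (he : M.Indep {e}) (𝒜 : Finset (Finset α))
    (h𝒜 : ∀ B ∈ 𝒜, B ⊆ gr M) (hra : ∀ B ∈ 𝒜, ∀ B' ∈ 𝒜, B ⊆ B' → rk M B = rk M B') :
    ∀ T ∈ (𝒜 \ Dropped M e 𝒜).image (fun B => B.erase e),
      ∀ T' ∈ (𝒜 \ Dropped M e 𝒜).image (fun B => B.erase e), T ⊆ T' →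
        rk (M ／ ({e} : Set α)) T = rk (M ／ ({e} : Set α)) T' := by
  have heE : e ∈ gr M := mem_gr_of_indep he
  intro T hT T' hT' hTT'
  rw [Finset.mem_image] at hT hT'
  obtain ⟨B, hB, rfl⟩ := hT
  obtain ⟨B', hB', rfl⟩ := hT'
  have hBA := (Finset.mem_sdiff.1 hB).1
  have hB'A := (Finset.mem_sdiff.1 hB').1
  by_cases heB : e ∈ B <;> by_cases heB' : e ∈ B'
  · -- both contain e: B ⊆ B'
    have hsub : B ⊆ B' := by
      intro x hx
      by_cases hxe : x = e
      · subst hxe; exact heB'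
      · exact Finset.mem_of_mem_erase (hTT' (Finset.mem_erase.2 ⟨hxe, hx⟩))
    have h1 := rk_contract_erase_of_mem he (h𝒜 B hBA) heB
    have h2 := rk_contract_erase_of_mem he (h𝒜 B' hB'A) heB'
    have h3 := hra B hBA B' hB'A hsub
    omega
  · -- e ∈ B, e ∉ B': B ∖ e ⊆ B'; either equal or B' would be dropped
    rw [Finset.erase_eq_of_notMem heB'] at hTT' ⊢
    by_contra hne
    apply (Finset.mem_sdiff.1 hB').2
    rw [mem_Dropped]
    exact ⟨hB'A, heB', B, hBA, heB, hTT', hne⟩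
  · -- e ∉ B, e ∈ B': B ⊆ B' ∖ e ⊆ B', so rk M B = rk M B' and e ∈ cl B
    rw [Finset.erase_eq_of_notMem heB] at hTT' ⊢
    have hsub : B ⊆ B' := hTT'.trans (Finset.erase_subset e B')
    have hr := hra B hBA B' hB'A hsub
    have hcl' : e ∈ clF M B' := by
      rw [← Finset.mem_coe, coe_clF]
      exact M.subset_closure _ (by rw [← coe_gr]; exact_mod_cast h𝒜 B' hB'A) (Finset.mem_coe.2 heB')
    have hcl : e ∈ clF M B := mem_clF_of_subset_of_rk_eq heE (h𝒜 B' hB'A) hsub hr hcl'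
    have h1 := rk_contract_of_notMem he (h𝒜 B hBA) heB
    rw [if_pos hcl] at h1
    have h2 := rk_contract_erase_of_mem he (h𝒜 B' hB'A) heB'
    omega
  · -- neither contains e: B ⊆ B', same rank, same closure membership of e
    rw [Finset.erase_eq_of_notMem heB] at hTT' ⊢
    rw [Finset.erase_eq_of_notMem heB'] at hTT' ⊢
    have hr := hra B hBA B' hB'A hTT'
    have h1 := rk_contract_of_notMem he (h𝒜 B hBA) heB
    have h2 := rk_contract_of_notMem he (h𝒜 B' hB'A) heB'
    by_cases hcl' : e ∈ clF M B'
    · have hcl : e ∈ clF M B := mem_clF_of_subset_of_rk_eq heE (h𝒜 B' hB'A) hTT' hr hcl'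
      rw [if_pos hcl] at h1; rw [if_pos hcl'] at h2; omega
    · have hcl : e ∉ clF M B := fun h => hcl' (by
        rw [← Finset.mem_coe, coe_clF] at h ⊢
        exact M.closure_subset_closure (by exact_mod_cast hTT') h)
      rw [if_neg hcl] at h1; rw [if_neg hcl'] at h2; omega


/-- **Proposition 2‴ (the rank-antichain step)**: for a non-loop `e` and a rank-antichain `𝒜` every dropped member of
which has `e ∈ cl(E − e − B)`, the RAS inequality for `(M, 𝒜, u)` follows from `RAS (M ＼ {e}) u` and
`RAS (M ／ {e}) (u − 1)`.  Collision pairs `{B, B ∪ {e}}` are paid by `pi_add_pi_insert_le`. -/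
theorem ras_step (he : M.Indep {e}) (hu : 1 ≤ u) (h1 : RAS (M ＼ ({e} : Set α)) u)
    (h2 : RAS (M ／ ({e} : Set α)) (u - 1)) (𝒜 : Finset (Finset α)) (h𝒜 : ∀ B ∈ 𝒜, B ⊆ gr M)
    (hra : ∀ B ∈ 𝒜, ∀ B' ∈ 𝒜, B ⊆ B' → rk M B = rk M B')
    (hdrop : ∀ B ∈ Dropped M e 𝒜, e ∈ clF M ((gr M \ B).erase e)) :
    ∑ B ∈ 𝒜, pi M u B ≤ ((shadowLevel M u 𝒜).card : ℚ) := by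
  have heE : e ∈ gr M := mem_gr_of_indep he
  set 𝒜₀ := 𝒜.filter (fun B => e ∉ B) with h𝒜₀
  set D := Dropped M e 𝒜 with hD
  set 𝒜₁ := (𝒜 \ D).image (fun B => B.erase e) with h𝒜₁
  have hDsub : D ⊆ 𝒜₀ := fun B hB => Finset.mem_filter.2 ⟨(mem_Dropped.1 hB).1, (mem_Dropped.1 hB).2.1⟩
  -- the two induction hypotheses
  have hd := h1 𝒜₀
    (fun B hB => by
      rw [gr_delete']
      exact Finset.subset_erase.2 ⟨h𝒜 B (Finset.mem_filter.1 hB).1, (Finset.mem_filter.1 hB).2⟩)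
    (fun B hB B' hB' hBB' => by
      have hB0 := Finset.mem_filter.1 hB
      have hB'0 := Finset.mem_filter.1 hB'
      rw [rk_delete (Finset.subset_erase.2 ⟨h𝒜 B hB0.1, hB0.2⟩),
        rk_delete (Finset.subset_erase.2 ⟨h𝒜 B' hB'0.1, hB'0.2⟩)]
      exact hra B hB0.1 B' hB'0.1 hBB')
  have hc := h2 𝒜₁
    (fun T hT => by
      rw [h𝒜₁, Finset.mem_image] at hT
      obtain ⟨B, hB, rfl⟩ := hT
      rw [gr_contract']
      exact Finset.erase_subset_erase e (h𝒜 B (Finset.mem_sdiff.1 hB).1))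
    (image_sdiff_Dropped_rankAntichain he 𝒜 h𝒜 hra)
  rw [h𝒜₁, shadowLevel_image_sdiff_Dropped] at hc
  -- the shadow split
  have hsplit : (shadowLevel M u 𝒜).card =
      (shadowLevel (M ＼ ({e} : Set α)) u 𝒜₀).card +
        (shadowLevel (M ／ ({e} : Set α)) (u - 1) (𝒜.image (fun B => B.erase e))).card := by
    rw [← Finset.card_filter_add_card_filter_not (s := shadowLevel M u 𝒜) (fun S => e ∉ S),
      shadowLevel_filter_notMem, shadowLevel_delete_filter, ← card_shadowLevel_filter_mem he hu 𝒜]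
    congr 2
    ext S
    simp only [Finset.mem_filter, not_not]
  -- the prices: fibers of `B ↦ B ∖ e` on the non-dropped members
  have hfib : ∑ B ∈ 𝒜 \ D, pi M u B =
      ∑ T ∈ 𝒜₁, ∑ B ∈ (𝒜 \ D).filter (fun B => B.erase e = T), pi M u B := by
    rw [h𝒜₁]
    exact (Finset.sum_fiberwise_of_maps_to (fun B hB => Finset.mem_image_of_mem _ hB) _).symm
  have hfibbound : ∀ T ∈ 𝒜₁, ∑ B ∈ (𝒜 \ D).filter (fun B => B.erase e = T), pi M u B ≤
      (if T ∈ 𝒜₀ \ D then pi (M ＼ ({e} : Set α)) u T else 0) + pi (M ／ ({e} : Set α)) (u - 1) T := by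
    intro T hT
    rw [h𝒜₁, Finset.mem_image] at hT
    obtain ⟨B₀, hB₀, hB₀T⟩ := hT
    have heT : e ∉ T := by rw [← hB₀T]; exact Finset.notMem_erase e B₀
    -- the fiber is contained in {T, insert e T}
    have hfibsub : (𝒜 \ D).filter (fun B => B.erase e = T) ⊆ {T, insert e T} := by
      intro B hB
      rw [Finset.mem_filter] at hB
      rw [Finset.mem_insert, Finset.mem_singleton]
      by_cases heB : e ∈ B
      · right; rw [← hB.2, Finset.insert_erase heB]
      · left; rw [← hB.2, Finset.erase_eq_of_notMem heB]
    have hTg : T ⊆ gr M := by rw [← hB₀T]; exact (Finset.erase_subset e B₀).trans (h𝒜 B₀ (Finset.mem_sdiff.1 hB₀).1)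
    -- membership of T and insert e T in the fiber
    have hTmem : T ∈ (𝒜 \ D).filter (fun B => B.erase e = T) ↔ T ∈ 𝒜 \ D := by
      rw [Finset.mem_filter]
      constructor
      · exact fun h => h.1
      · exact fun h => ⟨h, Finset.erase_eq_of_notMem heT⟩
    have hTemem : insert e T ∈ (𝒜 \ D).filter (fun B => B.erase e = T) ↔ insert e T ∈ 𝒜 := by
      rw [Finset.mem_filter]
      constructor
      · exact fun h => (Finset.mem_sdiff.1 h.1).1
      · intro h
        refine ⟨Finset.mem_sdiff.2 ⟨h, fun hd => (mem_Dropped.1 hd).2.1 (Finset.mem_insert_self _ _)⟩, ?_⟩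
        exact Finset.erase_insert heT
    have hT0 : T ∈ 𝒜₀ \ D ↔ T ∈ 𝒜 \ D := by
      rw [Finset.mem_sdiff, Finset.mem_sdiff, h𝒜₀, Finset.mem_filter]
      constructor
      · exact fun h => ⟨h.1.1, h.2⟩
      · exact fun h => ⟨⟨h.1, heT⟩, h.2⟩
    by_cases hTA : T ∈ 𝒜 \ D <;> by_cases hTeA : insert e T ∈ 𝒜
    · -- collision: both in the fiber
      have hfeq : (𝒜 \ D).filter (fun B => B.erase e = T) = {T, insert e T} := by
        apply Finset.Subset.antisymm hfibsub
        intro B hB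
        rw [Finset.mem_insert, Finset.mem_singleton] at hB
        rcases hB with rfl | rfl
        · exact hTmem.2 hTA
        · exact hTemem.2 hTeA
      have hne : T ≠ insert e T := fun h => heT (h ▸ Finset.mem_insert_self e T)
      rw [hfeq, Finset.sum_pair hne, if_pos (hT0.2 hTA)]
      -- same rank ⇒ e ∈ cl T
      have hcl : e ∈ clF M T := by
        have hr := hra T (Finset.mem_sdiff.1 hTA).1 (insert e T) hTeA (Finset.subset_insert e T)
        by_contra h
        have := rk_insert_eq heE hTg (e := e)
        rw [if_neg h] at this
        omega
      exact pi_add_pi_insert_le he hu hTg heT hcl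
    · -- only T
      have hfeq : (𝒜 \ D).filter (fun B => B.erase e = T) = {T} := by
        apply Finset.Subset.antisymm
        · intro B hB
          have := hfibsub hB
          rw [Finset.mem_insert, Finset.mem_singleton] at this
          rcases this with rfl | rfl
          · exact Finset.mem_singleton_self _
          · exact absurd (hTemem.1 hB) hTeA
        · intro B hB
          rw [Finset.mem_singleton] at hB
          subst hB
          exact hTmem.2 hTA
      rw [hfeq, Finset.sum_singleton, if_pos (hT0.2 hTA)]
      exact pi_le_delete_add_contract he hu hTg heT
    · -- only insert e T
      have hfeq : (𝒜 \ D).filter (fun B => B.erase e = T) = {insert e T} := by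
        apply Finset.Subset.antisymm
        · intro B hB
          have := hfibsub hB
          rw [Finset.mem_insert, Finset.mem_singleton] at this
          rcases this with rfl | rfl
          · exact absurd (hTmem.1 hB) hTA
          · exact Finset.mem_singleton_self _
        · intro B hB
          rw [Finset.mem_singleton] at hB
          subst hB
          exact hTemem.2 hTeA
      rw [hfeq, Finset.sum_singleton, if_neg (fun h => hTA (hT0.1 h)), zero_add]
      have h := pi_le_contract_erase he hu (Finset.insert_subset heE hTg) (Finset.mem_insert_self e T)
      rwa [Finset.erase_insert heT] at h
    · -- empty fiber: impossible, since B₀ is in it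
      exfalso
      have hB₀fib : B₀ ∈ (𝒜 \ D).filter (fun B => B.erase e = T) := Finset.mem_filter.2 ⟨hB₀, hB₀T⟩
      have := hfibsub hB₀fib
      rw [Finset.mem_insert, Finset.mem_singleton] at this
      rcases this with rfl | rfl
      · exact hTA hB₀
      · exact hTeA (Finset.mem_sdiff.1 hB₀).1
  -- dropped members are paid by the deletion side alone
  have hDpay : ∀ B ∈ D, pi M u B = pi (M ＼ ({e} : Set α)) u B := by
    intro B hB
    have hm := mem_Dropped.1 hB
    exact (pi_delete_eq_of_mem_closure he (h𝒜 B hm.1) hm.2.1 (hdrop B hB)).symm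
  -- assemble
  have hDA : D ⊆ 𝒜 := fun B hB => (mem_Dropped.1 hB).1
  have hsum𝒜 : ∑ B ∈ 𝒜, pi M u B = ∑ B ∈ 𝒜 \ D, pi M u B + ∑ B ∈ D, pi M u B := by
    rw [← Finset.sum_sdiff hDA]
  have hsum₀ : ∑ B ∈ 𝒜₀, pi (M ＼ ({e} : Set α)) u B =
      ∑ B ∈ 𝒜₀ \ D, pi (M ＼ ({e} : Set α)) u B + ∑ B ∈ D, pi (M ＼ ({e} : Set α)) u B := by
    rw [← Finset.sum_sdiff hDsub]
  have hind : ∑ T ∈ 𝒜₁, (if T ∈ 𝒜₀ \ D then pi (M ＼ ({e} : Set α)) u T else 0) =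
      ∑ T ∈ 𝒜₀ \ D, pi (M ＼ ({e} : Set α)) u T := by
    rw [Finset.sum_ite_mem]
    congr 1
    apply Finset.Subset.antisymm Finset.inter_subset_right
    intro T hT
    refine Finset.mem_inter.2 ⟨?_, hT⟩
    have hT' := Finset.mem_sdiff.1 hT
    have hT0 := Finset.mem_filter.1 hT'.1
    rw [h𝒜₁, Finset.mem_image]
    exact ⟨T, Finset.mem_sdiff.2 ⟨hT0.1, hT'.2⟩, Finset.erase_eq_of_notMem hT0.2⟩
  rw [hsplit, Nat.cast_add, hsum𝒜, Finset.sum_congr rfl hDpay]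
  calc ∑ B ∈ 𝒜 \ D, pi M u B + ∑ B ∈ D, pi (M ＼ ({e} : Set α)) u B
      ≤ ∑ T ∈ 𝒜₁, ((if T ∈ 𝒜₀ \ D then pi (M ＼ ({e} : Set α)) u T else 0) + pi (M ／ ({e} : Set α)) (u - 1) T) +
          ∑ B ∈ D, pi (M ＼ ({e} : Set α)) u B := by
        rw [hfib]
        exact add_le_add (Finset.sum_le_sum hfibbound) le_rfl
    _ = ∑ B ∈ 𝒜₀, pi (M ＼ ({e} : Set α)) u B + ∑ T ∈ 𝒜₁, pi (M ／ ({e} : Set α)) (u - 1) T := by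
        rw [Finset.sum_add_distrib, hind, hsum₀]; ring
    _ ≤ _ := add_le_add hd hc

end PercRepro.Skew
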